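import Summits.CriticalPhenomena.PercolationContinuityZ3.Theorems.PercNearOneGluingNoHeavyPcintNawChainPay
import Summits.CriticalPhenomena.PercolationContinuityZ3.Theorems.PercNearOneGluingNoHeavyPcintNawRandWindowCert
import HarnessLib

/-!
# PCINT lane, kind `nawchain_cw` (B2c): the rule on an extended window and its translation along a word

Cell `prim-pcint`, seat `prim-pcint-2` (gen 3); memo `run/shared/lean/prim/pcint/REDUCTIONS.md` §B2c.  Does NOT build on
p205010.

The B2c rule on windows of `m + 1` steps (memory `m + 2`: in the extended window all earlier vertices are visible):
for each of the `2d` lattice neighbours `x_e` of the new vertex, the payment `winPay` (`payW` of `…PcintNawChainPay` on the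
extended window), the deterministic-evidence flag `IsWinDet`, the corner direction `IsCornerDir`; the genuine counts
`winUnitsTrue` (payments with deterministic evidence) and `winCoinTrue` (payments of the corner site without deterministic
evidence, made only in the bad-coin world); and the translation lemmas identifying, for the windows of a
neighbour-avoiding word, the window-level data with the word-level data of `…PcintNawChainPay` (`payW_win_eq`,
`isDetW_win_iff`, `isCornerDir_win_iff`).  The per-word domination and the certificate theorem follow in
`…PcintNawChainWindowCert`.
-/

noncomputable section

namespace Summit.CriticalPhenomena.PercolationContinuityZ3.Theorems.Pcint

open Finset Literature.Probability.Percolation Literature.Probability.LatticeModels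

variable {d m : ℕ} (a₀ : Fin d × Bool)

/-! ### The rule on an extended window -/

/-- The lattice neighbour of the new vertex `P_{m+2}` in direction `e`. [folklore] -/
def winNbr (u : Fin (m + 1) → Fin d × Bool) (a e : Fin d × Bool) : Site d := wordPos (wext u a) (m + 2) + stepVec e

/-- Deterministic evidence for the neighbour in direction `e` (a window incidence at gap `≥ 4`). [folklore] -/
def IsWinDet (u : Fin (m + 1) → Fin d × Bool) (a e : Fin d × Bool) : Prop :=
  IsDetW (m + 2) (wext u a) (m + 2) (winNbr u a e)

/-- The payment of the neighbour in direction `e` (`0`, `1` or `2` units), chain parameter `kc`. [folklore] -/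
def winPay (kc : ℕ) (u : Fin (m + 1) → Fin d × Bool) (a e : Fin d × Bool) : ℕ :=
  payW (m + 2) kc (wext u a) (m + 2) (winNbr u a e)

/-- Direction `e` points at the corner site `P_m + a` of the last two steps. [folklore] -/
def IsCornerDir (u : Fin (m + 1) → Fin d × Bool) (a e : Fin d × Bool) : Prop :=
  winNbr u a e = wordPos (wext u a) m + stepVec a

open Classical in
/-- GENUINE unconditional units of the step: payments of neighbours with deterministic evidence. [folklore] -/
def winUnitsTrue (kc : ℕ) (u : Fin (m + 1) → Fin d × Bool) (a : Fin d × Bool) : ℕ :=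
  ∑ e : Fin d × Bool, if IsWinDet u a e then winPay kc u a e else 0

open Classical in
/-- GENUINE conditional units of the step: the payment of the corner site when it has no deterministic evidence
(made in the bad-coin world only). [folklore] -/
def winCoinTrue (kc : ℕ) (u : Fin (m + 1) → Fin d × Bool) (a : Fin d × Bool) : ℕ :=
  ∑ e : Fin d × Bool, if ¬ IsWinDet u a e ∧ IsCornerDir u a e then winPay kc u a e else 0

/-- The averaged coin factor `(1 + q̄^c)/2` of `c` conditional units (`1` for `c = 0`). [folklore] -/
def coinFactor (qb : ℝ) (c : ℕ) : ℝ := if c = 0 then 1 else (1 + qb ^ c) / 2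

/-! ### Windows of a neighbour-avoiding word: translation to the word -/

section Translate

variable {k : ℕ} {γ : Fin (m + 1 + k) → Fin d × Bool} (hs : IsSAW γ) (hch : chordEdges γ = ∅) {t : ℕ} (ht : t < k)

include ht in
/-- Positions of the extended window at `t`. [folklore] -/
theorem wordPos_win {j : ℕ} (hj : j ≤ m + 2) :
    wordPos (wext (winAt (m := m + 1) a₀ γ t) (wordAt a₀ γ (t + (m + 1)))) j = wordPos γ (t + j) - wordPos γ t :=
  wordPos_wext_winAt a₀ γ (by omega) hj

include ht in
/-- Incidence times of the extended window are translated incidence times of the word. [folklore] -/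
theorem mem_incTimes_win {x' : Site d} {i : ℕ} :
    i ∈ incTimes (wext (winAt (m := m + 1) a₀ γ t) (wordAt a₀ γ (t + (m + 1)))) x' ↔
      i ≤ m + 2 ∧ t + i ∈ incTimes γ (x' + wordPos γ t) := by
  rw [mem_incTimes, mem_incTimes]
  constructor
  · rintro ⟨hi, hadj⟩
    refine ⟨by omega, by omega, ?_⟩
    rw [wordPos_win a₀ ht (by omega)] at hadj
    rwa [← Literature.Probability.RandomPlanarGeometry.SAW.Zd.zdGraph_adj_sub_right _ _ (wordPos γ t), add_sub_cancel_right]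
  · rintro ⟨hi, -, hadj⟩
    refine ⟨by omega, ?_⟩
    rw [wordPos_win a₀ ht (by omega)]
    have := (Literature.Probability.RandomPlanarGeometry.SAW.Zd.zdGraph_adj_sub_right (wordPos γ (t + i))
      (x' + wordPos γ t) (wordPos γ t)).2 hadj
    rwa [add_sub_cancel_right] at this

include ht in
/-- Visible incidences of the extended window ↔ visible incidences of the word at time `t + m + 2`. [folklore] -/
theorem mem_visInc_win {x' : Site d} {i : ℕ} :
    i ∈ visInc (m + 2) (wext (winAt (m := m + 1) a₀ γ t) (wordAt a₀ γ (t + (m + 1)))) (m + 2) x' ↔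
      t + i ∈ visInc (m + 2) γ (t + m + 2) (x' + wordPos γ t) := by
  rw [mem_visInc, mem_visInc, mem_incTimes_win a₀ ht]
  constructor
  · rintro ⟨⟨-, h⟩, -, h2⟩; exact ⟨h, by omega, by omega⟩
  · rintro ⟨h, -, h2⟩; exact ⟨⟨by omega, h⟩, by omega, by omega⟩

include ht in
/-- Every visible incidence of the word at time `t + m + 2` comes from the window. [folklore] -/
theorem exists_visInc_win {x' : Site d} {i' : ℕ} (hi' : i' ∈ visInc (m + 2) γ (t + m + 2) (x' + wordPos γ t)) :
    ∃ i, i' = t + i ∧ i ∈ visInc (m + 2) (wext (winAt (m := m + 1) a₀ γ t) (wordAt a₀ γ (t + (m + 1)))) (m + 2) x' := by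
  have h := (mem_visInc.1 hi').2.1
  refine ⟨i' - t, by omega, ?_⟩
  rw [mem_visInc_win a₀ ht, show t + (i' - t) = i' by omega]
  exact hi'

include ht in
/-- Deterministic evidence: window ↔ word. [folklore] -/
theorem isDetW_win_iff {x' : Site d} :
    IsDetW (m + 2) (wext (winAt (m := m + 1) a₀ γ t) (wordAt a₀ γ (t + (m + 1)))) (m + 2) x' ↔
      IsDetW (m + 2) γ (t + m + 2) (x' + wordPos γ t) := by
  constructor
  · rintro ⟨i, hi, hi4⟩
    exact ⟨t + i, (mem_visInc_win a₀ ht).1 hi, by omega⟩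
  · rintro ⟨i', hi', hi4⟩
    obtain ⟨i, rfl, hi⟩ := exists_visInc_win a₀ ht hi'
    exact ⟨i, hi, by omega⟩

include ht in
/-- Bonus: window ↔ word. [folklore] -/
theorem isBonusW_win_iff (kc : ℕ) {x' : Site d} :
    IsBonusW (m + 2) kc (wext (winAt (m := m + 1) a₀ γ t) (wordAt a₀ γ (t + (m + 1)))) (m + 2) x' ↔
      IsBonusW (m + 2) kc γ (t + m + 2) (x' + wordPos γ t) := by
  constructor
  · rintro ⟨i, hi, hiK, hiso⟩
    refine ⟨t + i, (mem_visInc_win a₀ ht).1 hi, by omega, fun j' hj' hne => ?_⟩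
    obtain ⟨j, rfl, hj⟩ := exists_visInc_win a₀ ht hj'
    have := hiso j hj (fun h => hne (by rw [h]))
    omega
  · rintro ⟨i', hi', hiK, hiso⟩
    obtain ⟨i, rfl, hi⟩ := exists_visInc_win a₀ ht hi'
    refine ⟨i, hi, by omega, fun j hj hne => ?_⟩
    have := hiso (t + j) ((mem_visInc_win a₀ ht).1 hj) (fun h => hne (by omega))
    omega

include hch ht in
/-- Linked: window ↔ word (an off-window neighbour with a visible incidence is off the whole path, by the absence of
chords). [folklore] -/
theorem isLinkedW_win_iff (kc : ℕ) {x' : Site d} :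
    IsLinkedW (m + 2) kc (wext (winAt (m := m + 1) a₀ γ t) (wordAt a₀ γ (t + (m + 1)))) (m + 2) x' ↔
      IsLinkedW (m + 2) kc γ (t + m + 2) (x' + wordPos γ t) := by
  have htm : t + (m + 1) < m + 1 + k := by omega
  have hadjT : (zdGraph d).Adj (wordPos (wext (winAt (m := m + 1) a₀ γ t) (wordAt a₀ γ (t + (m + 1)))) (m + 2)) x' ↔
      (zdGraph d).Adj (wordPos γ (t + m + 2)) (x' + wordPos γ t) := by
    rw [wordPos_win a₀ ht le_rfl, ← Literature.Probability.RandomPlanarGeometry.SAW.Zd.zdGraph_adj_sub_right _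
      (x' + wordPos γ t) (wordPos γ t), add_sub_cancel_right, show t + (m + 2) = t + m + 2 by ring]
  constructor
  · rintro ⟨hadj, hoff, i, hi, hikc⟩
    have hadj' := hadjT.1 hadj
    have hi' := (mem_visInc_win a₀ ht).1 hi
    refine ⟨hadj', fun hmem => ?_, t + i, hi', by omega⟩
    obtain ⟨h, hh, hhx⟩ := mem_pathSites.1 hmem
    obtain ⟨hinc, -, hi2⟩ := mem_visInc.1 hi'
    obtain ⟨-, hai⟩ := mem_incTimes.1 hinc
    rw [← hhx] at hadj' hai
    rcases consecutive_of_adj hch (by omega) hh hadj' with h1 | h1 <;>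
      rcases consecutive_of_adj hch (by omega) hh hai with h2 | h2 <;> try omega
    -- `h = t + m + 1`: a window site
    refine hoff (mem_pathSites.2 ⟨m + 1, by omega, ?_⟩)
    rw [wordPos_win a₀ ht (by omega), show t + (m + 1) = h by omega, hhx, add_sub_cancel_right]
  · rintro ⟨hadj, hoff, i', hi', hikc⟩
    obtain ⟨i, rfl, hi⟩ := exists_visInc_win a₀ ht hi'
    refine ⟨hadjT.2 hadj, fun hmem => ?_, i, hi, by omega⟩
    obtain ⟨j, hj, hjx⟩ := mem_pathSites.1 hmem
    refine hoff (mem_pathSites.2 ⟨t + j, by omega, ?_⟩)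
    rw [wordPos_win a₀ ht (by omega)] at hjx
    rw [← hjx, sub_add_cancel]

include hch ht in
/-- Payments: window = word. [folklore] -/
theorem payW_win_eq (kc : ℕ) (x' : Site d) :
    payW (m + 2) kc (wext (winAt (m := m + 1) a₀ γ t) (wordAt a₀ γ (t + (m + 1)))) (m + 2) x' =
      payW (m + 2) kc γ (t + m + 2) (x' + wordPos γ t) := by
  unfold payW
  rw [show IsLinkedW (m + 2) kc (wext (winAt (m := m + 1) a₀ γ t) (wordAt a₀ γ (t + (m + 1)))) (m + 2) x' ↔
      IsLinkedW (m + 2) kc γ (t + m + 2) (x' + wordPos γ t) from isLinkedW_win_iff a₀ hch ht kc]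
  by_cases h : IsLinkedW (m + 2) kc γ (t + m + 2) (x' + wordPos γ t)
  · rw [if_pos h, if_pos h]
    by_cases hb : IsBonusW (m + 2) kc γ (t + m + 2) (x' + wordPos γ t)
    · rw [if_pos hb, if_pos ((isBonusW_win_iff a₀ ht kc).2 hb)]
    · rw [if_neg hb, if_neg (fun h' => hb ((isBonusW_win_iff a₀ ht kc).1 h'))]
  · rw [if_neg h, if_neg h]

include ht in
/-- The neighbour sites of the window, translated. [folklore] -/
theorem winNbr_add (e : Fin d × Bool) :
    winNbr (winAt (m := m + 1) a₀ γ t) (wordAt a₀ γ (t + (m + 1))) e + wordPos γ t = wordPos γ (t + m + 2) + stepVec e := by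
  rw [winNbr, wordPos_win a₀ ht le_rfl, show t + (m + 2) = t + m + 2 by ring]; abel

include ht in
/-- The corner direction, translated: it points at `cornerSite γ (t + m)`. [folklore] -/
theorem isCornerDir_win_iff (e : Fin d × Bool) :
    IsCornerDir (winAt (m := m + 1) a₀ γ t) (wordAt a₀ γ (t + (m + 1))) e ↔
      wordPos γ (t + m + 2) + stepVec e = cornerSite γ (t + m) := by
  have htm : t + (m + 1) < m + 1 + k := by omega
  have hcs : cornerSite γ (t + m) = wordPos γ (t + m) + stepVec (wordAt a₀ γ (t + (m + 1))) := by
    rw [cornerSite, dif_pos (by omega : t + m + 1 < m + 1 + k), wordAt_of_lt a₀ γ htm]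
    congr 3
  rw [IsCornerDir, ← winNbr_add a₀ ht e, hcs, wordPos_win a₀ ht (by omega)]
  constructor
  · intro h; rw [h]; abel
  · intro h
    have := congrArg (fun z => z - wordPos γ t) h
    simp only [add_sub_cancel_right] at this
    rw [this]; abel

end Translate

end Summit.CriticalPhenomena.PercolationContinuityZ3.Theorems.Pcint
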